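import Mathlib
import Summits.ResolutionOfSingularities.ResolutionOfSingularities.Theorems.HomologicalConductorPersistenceCyclicQuotientGradedPieces
import HarnessLib

/-!
# Rung S-2 `PersistenceSurface` (stmt-19970), stub C1 (`Sat₄`) — weight pieces of `k[u,v]` over
# `U = k[u,v]^{(n;1,q)}` in EVERY CHARACTERISTIC: classes of staircase quotients and GENERATION FROM A COVERING
# STAIRCASE (char-free port of part 22's criterion; seat leafhand-res-homologicalconduct-13 gen 1)

[OURS · cell decomp-res · rung S-2] Nothing here is a statement of the manuscript under review (Hironaka 2017);
AI-written, weaker than expert review.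

Class bookkeeping for monomial staircases with the WEIGHT PIECES of `…CyclicQuotientGradedPieces`
(`p ∈ M a ↔ weightedHomogeneousComponent (1,q) a p = p`, `k` any field, `p = char k ∣ n` allowed):

* `whc_stair_quotient` — if `∑_{s ≤ t} w_s g_s = u^{c_t} v^{j_{t+1}} r_t` with degree-`0` coefficients `w_s` and
  staircase monomials `g_s = u^{c_s} v^{j_s}` of class `a`, then `r_t` lies in the piece `a − (c_t + q j_{t+1})`.
* **`piece_eq_span_of_cover`** — a staircase of class `a` that COVERS `[0, J]` (`q J ≡ a`; every column `i ≤ J`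
  dominated by a generator `j_s ≤ i`, `c_s ≤ (a − q i) mod n`) generates the piece: `M a = span_U {u^{c_s} v^{j_s}}`.

The resolution itself is the next part (`…CyclicQuotientGradedStaircase`).  No crux, kill test or summit statement is
proved here.

References: folklore; res-L1-w44b-idea-1 SC-TORIC v2 §2(e) (OURS, memo).
-/

-- single-problem summit: the doubled namespace component `ResolutionOfSingularities` is forced
set_option linter.dupNamespace false

noncomputable section

open CategoryTheory Literature.RingTheory.CohomologyAnnihilator MvPolynomial
open Summit.ResolutionOfSingularities.ResolutionOfSingularities.Theorems.HomologicalConductor.PersistenceCyclicQuotientGradedPieces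

universe u

namespace Summit.ResolutionOfSingularities.ResolutionOfSingularities.Theorems.HomologicalConductor.PersistenceCyclicQuotientGradedStairCover

variable {k : Type u} [Field k] {n : ℕ} [NeZero n] (q : ℕ)

/-! ## Classes of the staircase quotients -/

/-- **The staircase quotient lies in the shifted piece.**  If `∑_{s ≤ t} w_s g_s = u^{c_t} v^{j_{t+1}} r_t` with
degree-`0` `w_s` and all `g_s = u^{c_s} v^{j_s}` of class `a`, then `r_t` lies in the piece `a − (c_t + q j_{t+1})`.
[folklore] -/
theorem whc_stair_quotient (c j : ℕ → ℕ) (a : ZMod n) (w r : ℕ → MvPolynomial (Fin 2) k) (t : ℕ)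
    (hw : ∀ s, s ≤ t → weightedHomogeneousComponent (![1, (q : ZMod n)] : Fin 2 → ZMod n) 0 (w s) = w s)
    (hcl : ∀ s, s ≤ t → ((c s + q * j s : ℕ) : ZMod n) = a)
    (hS : ∑ s ∈ Finset.range (t + 1), w s * monomial (Finsupp.single 0 (c s) + Finsupp.single 1 (j s)) (1 : k) =
      monomial (Finsupp.single 0 (c t) + Finsupp.single 1 (j (t + 1))) 1 * r t) :
    weightedHomogeneousComponent (![1, (q : ZMod n)] : Fin 2 → ZMod n) (a - ((c t + q * j (t + 1) : ℕ) : ZMod n)) (r t) =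
      r t := by
  classical
  -- the partial sum has class `a`
  have hSum : weightedHomogeneousComponent (![1, (q : ZMod n)] : Fin 2 → ZMod n) a
      (∑ s ∈ Finset.range (t + 1), w s * monomial (Finsupp.single 0 (c s) + Finsupp.single 1 (j s)) (1 : k)) =
      ∑ s ∈ Finset.range (t + 1), w s * monomial (Finsupp.single 0 (c s) + Finsupp.single 1 (j s)) (1 : k) := by
    rw [map_sum]
    refine Finset.sum_congr rfl fun s hs => ?_
    rw [Finset.mem_range] at hs
    have hg := whc_monomial (n := n) q (Finsupp.single 0 (c s) + Finsupp.single 1 (j s) : Fin 2 →₀ ℕ) (1 : k)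
    have hwt : (((Finsupp.single 0 (c s) + Finsupp.single 1 (j s) : Fin 2 →₀ ℕ) 0 +
        q * (Finsupp.single 0 (c s) + Finsupp.single 1 (j s) : Fin 2 →₀ ℕ) 1 : ℕ) : ZMod n) = a := by
      rw [← hcl s (Nat.le_of_lt_succ hs)]; simp
    rw [hwt] at hg
    have h := whc_mul q 0 a (w s) _ (hw s (Nat.le_of_lt_succ hs)) hg
    rwa [zero_add] at h
  have h := whc_of_monomial_mul q (Finsupp.single 0 (c t) + Finsupp.single 1 (j (t + 1))) a (r t) (by rw [← hS]; exact hSum)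
  have hwt : (((Finsupp.single 0 (c t) + Finsupp.single 1 (j (t + 1)) : Fin 2 →₀ ℕ) 0 +
      q * (Finsupp.single 0 (c t) + Finsupp.single 1 (j (t + 1)) : Fin 2 →₀ ℕ) 1 : ℕ) : ZMod n) =
      ((c t + q * j (t + 1) : ℕ) : ZMod n) := by simp
  rwa [hwt] at h

/-! ## Generation from a covering staircase -/

section Stair

variable (U : Subalgebra k (MvPolynomial (Fin 2) k))
variable (hU : ∀ p, p ∈ U ↔ weightedHomogeneousComponent (![1, (q : ZMod n)] : Fin 2 → ZMod n) 0 p = p)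
variable (M : ZMod n → Submodule U ((restrictScalarsFunctor U (MvPolynomial (Fin 2) k)).obj
  (ModuleCat.of (MvPolynomial (Fin 2) k) (MvPolynomial (Fin 2) k))))
variable (hM : ∀ (a : ZMod n) (p : MvPolynomial (Fin 2) k),
  (show ((restrictScalarsFunctor U (MvPolynomial (Fin 2) k)).obj
    (ModuleCat.of (MvPolynomial (Fin 2) k) (MvPolynomial (Fin 2) k))) from p) ∈ M a ↔
  weightedHomogeneousComponent (![1, (q : ZMod n)] : Fin 2 → ZMod n) a p = p)

omit [NeZero n] in
include hU hM in
/-- **GENERATION FROM A COVERING STAIRCASE (every characteristic).**  Let `(c_s, j_s)_{s ≤ μ}` be exponents of class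
`a` (`c_s + q j_s ≡ a`) and `J` with `q J ≡ a`.  If every column `i ≤ J` is COVERED — some `s ≤ μ` has `j_s ≤ i` and
`c_s ≤ (a − q i) mod n` — then the piece `M a` IS the `U`-span of the monomials `u^{c_s} v^{j_s}`, `s ≤ μ`.
[folklore; OURS · cell decomp-res] -/
theorem piece_eq_span_of_cover (a : ZMod n) (μ J : ℕ) (c j : ℕ → ℕ)
    (hcl : ∀ s, ((c s + q * j s : ℕ) : ZMod n) = a) (hJ : ((q * J : ℕ) : ZMod n) = a)
    (hcover : ∀ i, i ≤ J → ∃ s, s ≤ μ ∧ j s ≤ i ∧ c s ≤ ((a - ((q * i : ℕ) : ZMod n) : ZMod n)).val) :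
    M a = Submodule.span U (Set.range fun s : Fin (μ + 1) =>
      (show ((restrictScalarsFunctor U (MvPolynomial (Fin 2) k)).obj
          (ModuleCat.of (MvPolynomial (Fin 2) k) (MvPolynomial (Fin 2) k))) from
            monomial (Finsupp.single 0 (c s) + Finsupp.single 1 (j s)) (1 : k))) := by
  classical
  refine le_antisymm ?_ (Submodule.span_le.mpr ?_)
  · intro w hw
    let toWh : MvPolynomial (Fin 2) k →+ ((restrictScalarsFunctor U (MvPolynomial (Fin 2) k)).obj
            (ModuleCat.of (MvPolynomial (Fin 2) k) (MvPolynomial (Fin 2) k))) :=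
      { toFun := fun p => p, map_zero' := rfl, map_add' := fun _ _ => rfl }
    let ofW : ((restrictScalarsFunctor U (MvPolynomial (Fin 2) k)).obj
            (ModuleCat.of (MvPolynomial (Fin 2) k) (MvPolynomial (Fin 2) k))) → MvPolynomial (Fin 2) k := fun w => w
    have hsupp : ∀ d ∈ (ofW w).support, ((d 0 + q * d 1 : ℕ) : ZMod n) = a :=
      (whc_eq_self_iff q a (ofW w)).mp ((hM a (ofW w)).mp hw)
    have hw' : w = toWh (∑ d ∈ (ofW w).support, monomial d (coeff d (ofW w))) :=
      congr_arg toWh (ofW w).as_sum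
    rw [hw', map_sum]
    refine Submodule.sum_mem _ fun d hd => ?_
    -- the covering generator below `min (d 1) J`
    obtain ⟨s, hsμ, hjs', hcs'⟩ := hcover (min (d 1) J) (min_le_right _ _)
    have hc₀le : ((a - ((q * min (d 1) J : ℕ) : ZMod n) : ZMod n)).val ≤ d 0 := by
      by_cases hβ : d 1 ≤ J
      · rw [min_eq_left hβ]
        have : ((d 0 : ℕ) : ZMod n) = a - ((q * d 1 : ℕ) : ZMod n) := by
          rw [← hsupp d hd, Nat.cast_add]; ring
        rw [← this, ZMod.val_natCast]
        exact Nat.mod_le _ _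
      · push Not at hβ
        rw [min_eq_right (le_of_lt hβ), ← hJ, sub_self, ZMod.val_zero]
        exact Nat.zero_le _
    have hcs : c s ≤ d 0 := hcs'.trans hc₀le
    have hjs : j s ≤ d 1 := hjs'.trans (min_le_left _ _)
    -- the degree-`0` cofactor
    let r : Fin 2 →₀ ℕ := Finsupp.single 0 (d 0 - c s) + Finsupp.single 1 (d 1 - j s)
    have hexp : r + (Finsupp.single 0 (c s) + Finsupp.single 1 (j s)) = d := by
      ext i; fin_cases i
      · simp [r]; omega
      · simp [r]; omega
    have hrU : monomial r (coeff d (ofW w)) ∈ U := by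
      rw [hU, whc_eq_self_iff]
      intro d' hd'
      rw [support_monomial] at hd'
      split_ifs at hd' with h0
      · exact absurd hd' (Finset.notMem_empty _)
      · rw [Finset.mem_singleton] at hd'
        subst hd'
        have h1 := hsupp d hd
        have h2 := hcl s
        have heq : (((r 0 + q * r 1 : ℕ) : ZMod n)) + ((c s + q * j s : ℕ) : ZMod n) =
            ((d 0 + q * d 1 : ℕ) : ZMod n) := by
          push_cast
          simp only [r, Finsupp.coe_add, Pi.add_apply, Finsupp.single_eq_same, Finsupp.single_eq_of_ne (one_ne_zero),
            Finsupp.single_eq_of_ne (zero_ne_one), add_zero, zero_add]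
          rw [Nat.cast_sub hcs, Nat.cast_sub hjs]
          ring
        rw [h1, h2] at heq
        exact add_eq_right.mp heq
    have hdecomp : toWh (monomial d (coeff d (ofW w))) = (⟨monomial r (coeff d (ofW w)), hrU⟩ : U) •
        toWh (monomial (Finsupp.single 0 (c s) + Finsupp.single 1 (j s)) 1) := by
      change monomial d (coeff d (ofW w)) =
        monomial r (coeff d (ofW w)) * monomial (Finsupp.single 0 (c s) + Finsupp.single 1 (j s)) 1
      rw [monomial_mul, mul_one, hexp]
    rw [hdecomp]
    exact Submodule.smul_mem _ _ (Submodule.subset_span ⟨⟨s, Nat.lt_succ_of_le hsμ⟩, rfl⟩)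
  · rintro _ ⟨s, rfl⟩
    have h := monomial_mem_piece q U M hM (Finsupp.single 0 (c s) + Finsupp.single 1 (j s)) (1 : k)
    have hwt : Finsupp.weight (![1, (q : ZMod n)] : Fin 2 → ZMod n)
        (Finsupp.single 0 (c s) + Finsupp.single 1 (j s) : Fin 2 →₀ ℕ) = a := by
      rw [weight_eq, ← hcl s]; simp
    rw [hwt] at h
    exact h

end Stair

end Summit.ResolutionOfSingularities.ResolutionOfSingularities.Theorems.HomologicalConductor.PersistenceCyclicQuotientGradedStairCover

end
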